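import Summits.HodgeConjecture.HodgeConjecture.Theorems.MarkmanPartnerTransportIsometrySpannedThirdOfGraphClassesRoute

/-!
# Route MarkmanPartnerTransport · support #3 `IsometrySpannedThird` — the graph classes made EXPLICIT:
# `κ_g := Σ_{ij} (q⁻¹)_{ij} · φ⁻¹eᵢ ∪ g(φ⁻¹eⱼ)` has cubic form `(tr g)·q(y,w) + q(gy,w) + q(gw,y)`, so
# `IsometrySpannedThird` holds at every Picard rank as soon as the classes `κ_g` are algebraic

`…IsometrySpannedThirdOfGraphClasses(Route)` reduce the item `IsometrySpannedThird` (every Picard rank, no K3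
partner) to the EXISTENCE, for each bijective rational Hodge `q`-isometry `g` of `H²(X)`, of an algebraic class
with cubic form `t·q(y,w) + q(gy,w) + q(gw,y)`. This file names the class: with `eᵢ` the standard basis of
`ℂ²³`, `G = Λ_{K3} ⊕ ⟨−2⟩` the Gram matrix of `q` (`det G = 2`) and `G⁻¹` its inverse over `ℂ`,
`κ_g := Σ_{i,j} (G⁻¹)_{ij} · φ⁻¹eᵢ ∪ g(φ⁻¹eⱼ) ∈ H⁴(X)` — the pull-back along the diagonal of `(id ⊗ g)` applied to
the Beauville–Bogomolov tensor `q⁻¹ ∈ H² ⊗ H²` — satisfies `(κ_g ∪ y) ∪ w = (t·q(y,w) + q(gy,w) + q(gw,y))·P`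
(polarised Fujiki `cupFour_eq_of_isMarkedK3Hilb` and `Σ (G⁻¹)_{ij} q(eᵢ,u) q(eⱼ,v) = q(u,v)`). Hence:

* `k3HilbertForm_inverse_sum` — `Σ_{ij} (G⁻¹)_{ij} q(eᵢ, u) q(eⱼ, v) = q(u, v)` on `ℂ²³`;
* `graphClasses_of_kappaClasses` — `κ_g` algebraic for all such `g` ⇒ the hypothesis `Graph` of
  `…OfGraphClasses`;
* `hodgeConjectureFor_of_spannedByIsometries_of_kappaClasses`, `isometrySpannedThird_of_kappaClasses` —
  **`IsometrySpannedThird` BY NAME, every Picard rank, from {Verbitsky–Guan, O'Grady, Voisin} and the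
  algebraicity of the explicit classes `κ_g`** — the form in which Markman 2024 (the class of `g` in `H⁸(X × X)` is
  algebraic) and Charles–Markman 2013 (Lefschetz standard conjecture in degree `2`: the inverse BBF
  correspondence `H⁶ → H²` is algebraic) would deliver it, once composition of correspondences is in the tree.

CONDITIONAL; credits nothing. No definition, no sorry. References: E. Markman, Compos. Math. 160 (2024)
Thm. 1.1; F. Charles and E. Markman, Compos. Math. 149 (2013) Thm. 1.1; A. Fujiki, Adv. Stud. Pure Math. 10
(1987); K. O'Grady, *Mat. Contemp.* (2008) §2.
-/

noncomputable section

set_option linter.dupNamespace false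

open Module CategoryTheory
open Literature.AlgebraicTopology.SingularHomology Literature.Geometry.Kaehler
open Literature.AlgebraicGeometry Literature.AlgebraicGeometry.Motives Literature.AlgebraicGeometry.HodgeTheory
open Literature.AlgebraicGeometry.Hyperkaehler Literature.AlgebraicGeometry.Surfaces
open Summit.HodgeConjecture.HodgeConjecture.Theorems.NikulinTwinTransport
open Summit.HodgeConjecture.HodgeConjecture.Theorems.MarkmanPartnerTransport.BBFPositivity

namespace Summit.HodgeConjecture.HodgeConjecture.Theorems.MarkmanPartnerTransport.PartnerLattice

/-- `MarkedK3Sq[X, φ, P, z]`: VERBATIM the `let MarkedK3Sq := …` binder of the route declarations of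
MarkmanPartnerTransport (clauses (m1)–(m6)). Local notation only. -/
local notation3 (prettyPrint := false) "MarkedK3Sq[" X ", " φ ", " P ", " z "]" =>
  (((IsIntegralClass P ∧ ∀ Q : complexBetti X (2 * 4), IsIntegralClass Q → ∃ n : ℤ, Q = n • P) ∧
    (∀ c : complexBetti X 2, IsIntegralClass c ↔ ∃ v : K3HilbertIndex → ℤ, φ c = fun i => (v i : ℂ)) ∧
    (∀ a : complexBetti X 2, cupPowTwo a 4 = ((3 : ℂ) * (k3HilbertForm 2 (φ a) (φ a)) ^ 2) • P) ∧
    (IsOfHodgeType 4 X 2 2 0 (LinearEquiv.symm φ z) ∧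
      ∀ τ : complexBetti X 2, IsOfHodgeType 4 X 2 2 0 τ → ∃ t : ℂ, τ = t • LinearEquiv.symm φ z) ∧
    (∀ c : complexBetti X 2, IsOfHodgeType 4 X 2 1 1 c ↔
      (k3HilbertForm 2 (φ c) z = 0 ∧ k3HilbertForm 2 (φ c) (star z) = 0)) ∧
    (k3HilbertForm 2 z z = 0 ∧ 0 < (k3HilbertForm 2 (star z) z).re)))

/-- `Cup3[c, y, w] = (c ∪ y) ∪ w ∈ H⁸` for `c ∈ H⁴`, `y, w ∈ H²`. Local notation only. -/
local notation3 (prettyPrint := false) "Cup3[" c ", " y ", " w "]" =>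
  cupProduct (rfl : 2 * 3 + 2 = 2 * 4) (cupProduct (rfl : 2 * 2 + 2 = 2 * 3) c y) w

variable {X : SchemeOver ℂ} {φ : complexBetti X 2 ≃ₗ[ℂ] (K3HilbertIndex → ℂ)} {P : complexBetti X (2 * 4)}
  {z : K3HilbertIndex → ℂ}

/-- `SpannedByIso[X, φ]`: VERBATIM the `let SpannedByIsometries := …` binder of the route declarations (with
`IsBBFTransc` inlined). Local notation only. -/
local notation3 (prettyPrint := false) "SpannedByIso[" X ", " φ "]" =>
  ∀ f : complexBetti X 2 →ₗ[ℂ] complexBetti X 2, (∀ y, IsRationalClass y → IsRationalClass (f y)) →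
    (∀ (i j : ℕ) y, IsOfHodgeType 4 X 2 i j y → IsOfHodgeType 4 X 2 i j (f y)) →
    (∀ d : complexBetti X 2, d ∈ algebraicClasses X 1 → f d = 0) →
    (∀ y : complexBetti X 2, ∀ d : complexBetti X 2, d ∈ algebraicClasses X 1 →
      k3HilbertForm 2 (φ (f y)) (φ d) = 0) →
    ∃ (k : ℕ) (c : Fin k → ℚ) (g : Fin k → (complexBetti X 2 →ₗ[ℂ] complexBetti X 2)),
      (∀ i, Function.Bijective (g i) ∧ (∀ y, IsRationalClass y → IsRationalClass (g i y)) ∧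
        (∀ (a b : ℕ) y, IsOfHodgeType 4 X 2 a b y → IsOfHodgeType 4 X 2 a b (g i y)) ∧
        (∀ a b, k3HilbertForm 2 (φ (g i a)) (φ (g i b)) = k3HilbertForm 2 (φ a) (φ b))) ∧
      ∀ y : complexBetti X 2, (∀ d : complexBetti X 2, d ∈ algebraicClasses X 1 →
        k3HilbertForm 2 (φ y) (φ d) = 0) → f y = ∑ i : Fin k, ((c i : ℂ) • g i y)

/-- `Graph[X, φ, P]`: the geometric input — for every bijective rational Hodge `q`-isometry `g` of `H²(X)` an
ALGEBRAIC class `c_g ∈ A²(X)` and `t ∈ ℂ` with `(c_g ∪ y) ∪ w = (t·q(y,w) + q(gy,w) + q(gw,y))·P`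
(intended: `c_g = Δ^*(Γ_g ∘ q⁻¹)`, `t = tr g`; Markman 2024 + Charles–Markman 2013). Local notation only. -/
local notation3 (prettyPrint := false) "Graph[" X ", " φ ", " P "]" =>
  ∀ g : complexBetti X 2 →ₗ[ℂ] complexBetti X 2, Function.Bijective g →
    (∀ y, IsRationalClass y → IsRationalClass (g y)) →
    (∀ (a b : ℕ) y, IsOfHodgeType 4 X 2 a b y → IsOfHodgeType 4 X 2 a b (g y)) →
    (∀ a b, k3HilbertForm 2 (φ (g a)) (φ (g b)) = k3HilbertForm 2 (φ a) (φ b)) →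
    ∃ cg ∈ algebraicClasses X 2, ∃ t : ℂ, ∀ y w : complexBetti X 2,
      Cup3[cg, y, w] = (t * k3HilbertForm 2 (φ y) (φ w) + k3HilbertForm 2 (φ (g y)) (φ w) +
        k3HilbertForm 2 (φ (g w)) (φ y)) • P

/-- `Kappa[X, φ]`: for every bijective rational Hodge `q`-isometry `g` of `H²(X)` the explicit class
`κ_g = Σ_{ij} (G⁻¹)_{ij} · φ⁻¹eᵢ ∪ g(φ⁻¹eⱼ)` is algebraic. Local notation only. -/
local notation3 (prettyPrint := false) "Kappa[" X ", " φ "]" =>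
  ∀ g : complexBetti X 2 →ₗ[ℂ] complexBetti X 2, Function.Bijective g →
    (∀ y, IsRationalClass y → IsRationalClass (g y)) →
    (∀ (a b : ℕ) y, IsOfHodgeType 4 X 2 a b y → IsOfHodgeType 4 X 2 a b (g y)) →
    (∀ a b, k3HilbertForm 2 (φ (g a)) (φ (g b)) = k3HilbertForm 2 (φ a) (φ b)) →
    (∑ i : K3HilbertIndex, ∑ j : K3HilbertIndex,
      (((k3HilbertGram 2).map (Int.cast : ℤ → ℂ))⁻¹ i j) •
        cupProduct (rfl : 2 + 2 = 2 * 2) ((LinearEquiv.symm φ) (Pi.single i 1))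
          (g ((LinearEquiv.symm φ) (Pi.single j 1)))) ∈ algebraicClasses X 2

/-- **`Σ_{ij} (G⁻¹)_{ij} q(eᵢ, u) q(eⱼ, v) = q(u, v)`** for the Beauville–Bogomolov form of `K3^{[2]}`-type on `ℂ²³`
(`G = Λ_{K3} ⊕ ⟨−2⟩`, `det G = 2 ≠ 0`): the inverse Gram matrix contracts two evaluations of `q` back to `q`.
[cite: OGrady2008NumericalK3Square, §2.1 (2.1.2)] -/
theorem k3HilbertForm_inverse_sum (u v : K3HilbertIndex → ℂ) :
    ∑ i, ∑ j, ((k3HilbertGram 2).map (Int.cast : ℤ → ℂ))⁻¹ i j *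
      k3HilbertForm 2 (Pi.single i 1) u * k3HilbertForm 2 (Pi.single j 1) v = k3HilbertForm 2 u v := by
  classical
  have hdet : IsUnit ((k3HilbertGram 2).map (Int.cast : ℤ → ℂ)).det := by
    rw [← Int.cast_det, k3HilbertGram_two_det, isUnit_iff_ne_zero]; norm_num
  have hq : ∀ a b : K3HilbertIndex → ℂ,
      k3HilbertForm 2 a b = a ⬝ᵥ ((k3HilbertGram 2).map (Int.cast : ℤ → ℂ)).mulVec b := fun a b => by
    simp only [k3HilbertForm_apply, dotProduct, Matrix.mulVec, Matrix.map_apply, Finset.mul_sum]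
    exact Finset.sum_congr rfl fun i _ => Finset.sum_congr rfl fun j _ => by ring
  have hsingle : ∀ (i : K3HilbertIndex) (a : K3HilbertIndex → ℂ),
      k3HilbertForm 2 (Pi.single i 1) a = ((k3HilbertGram 2).map (Int.cast : ℤ → ℂ)).mulVec a i := fun i a => by
    rw [hq, single_dotProduct, one_mul]
  have e1 : ∀ U V : K3HilbertIndex → ℂ, ∑ i, ∑ j, ((k3HilbertGram 2).map (Int.cast : ℤ → ℂ))⁻¹ i j * U i * V j =
      U ⬝ᵥ (((k3HilbertGram 2).map (Int.cast : ℤ → ℂ))⁻¹).mulVec V := fun U V => by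
    simp only [dotProduct, Matrix.mulVec, Finset.mul_sum]
    exact Finset.sum_congr rfl fun i _ => Finset.sum_congr rfl fun j _ => by ring
  simp_rw [hsingle]
  rw [e1, Matrix.mulVec_mulVec, Matrix.nonsing_inv_mul _ hdet, Matrix.one_mulVec, dotProduct_comm, ← hq,
    k3HilbertForm_comm]

/-- **The explicit graph classes have the right cubic form**: if the classes `κ_g` are algebraic (`Kappa`), the
hypothesis `Graph` of `…IsometrySpannedThirdOfGraphClasses` holds, with `c_g := κ_g` and
`t := Σ (G⁻¹)_{ij} q(eᵢ, φ g φ⁻¹ eⱼ)` (`= tr g`): by polarised Fujiki,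
`(φ⁻¹eᵢ ∪ g φ⁻¹eⱼ ∪ y) ∪ w = (q(eᵢ, g eⱼ) q(y,w) + q(eᵢ,y) q(g eⱼ,w) + q(eᵢ,w) q(g eⱼ,y))·P`, and
`Σ (G⁻¹)_{ij} q(eᵢ, y) q(g eⱼ, w) = Σ (G⁻¹)_{ij} q(eᵢ, y) q(eⱼ, g⁻¹w) = q(y, g⁻¹ w) = q(gy, w)` (`g` an isometry).
[cite: OGrady2008NumericalK3Square, §2.2 Remark 2.1] [cite: Markman2024, §1.1 Thm. 1.1] -/
theorem graphClasses_of_kappaClasses (hM : MarkedK3Sq[X, φ, P, z]) (hκ : Kappa[X, φ]) : Graph[X, φ, P] := by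
  classical
  have hmk : IsMarkedK3Hilb 2 X φ P := isMarkedK3Hilb_of_marked hM
  intro g hbij hrat hh hiso
  refine ⟨_, hκ g hbij hrat hh hiso, ∑ i, ∑ j, ((k3HilbertGram 2).map (Int.cast : ℤ → ℂ))⁻¹ i j *
    k3HilbertForm 2 (Pi.single i 1) (φ (g ((LinearEquiv.symm φ) (Pi.single j 1)))), fun y w => ?_⟩
  have hL2 : ∀ (u : ℂ) (A : complexBetti X (2 * 2)), Cup3[u • A, y, w] = u • Cup3[A, y, w] := by
    intro u A; simp only [map_smul, LinearMap.smul_apply]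
  have hL3 : ∀ A : K3HilbertIndex → complexBetti X (2 * 2), Cup3[∑ i, A i, y, w] = ∑ i, Cup3[A i, y, w] := by
    intro A; simp only [map_sum, LinearMap.sum_apply]
  have hvv : ∀ i j, Cup3[cupProduct (rfl : 2 + 2 = 2 * 2) ((LinearEquiv.symm φ) (Pi.single i 1))
      (g ((LinearEquiv.symm φ) (Pi.single j 1))), y, w] =
      (k3HilbertForm 2 (Pi.single i 1) (φ (g ((LinearEquiv.symm φ) (Pi.single j 1)))) *
            k3HilbertForm 2 (φ y) (φ w) +
          k3HilbertForm 2 (Pi.single i 1) (φ y) *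
            k3HilbertForm 2 (φ (g ((LinearEquiv.symm φ) (Pi.single j 1)))) (φ w) +
        k3HilbertForm 2 (Pi.single i 1) (φ w) *
          k3HilbertForm 2 (φ (g ((LinearEquiv.symm φ) (Pi.single j 1)))) (φ y)) • P := by
    intro i j
    have h := (cupFour_def _ _ _ _).symm.trans (cupFour_eq_of_isMarkedK3Hilb hmk
      ((LinearEquiv.symm φ) (Pi.single i 1)) (g ((LinearEquiv.symm φ) (Pi.single j 1))) y w)
    rw [LinearEquiv.apply_symm_apply] at h
    exact h
  -- the key contraction: `Σ (G⁻¹)_{ij} q(eᵢ, y) q(g eⱼ, w) = q(g y, w)`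
  have hS : ∀ y w : complexBetti X 2, ∑ i, ∑ j, ((k3HilbertGram 2).map (Int.cast : ℤ → ℂ))⁻¹ i j *
      k3HilbertForm 2 (Pi.single i 1) (φ y) *
        k3HilbertForm 2 (φ (g ((LinearEquiv.symm φ) (Pi.single j 1)))) (φ w) =
      k3HilbertForm 2 (φ (g y)) (φ w) := by
    intro y w
    obtain ⟨w', rfl⟩ := hbij.2 w
    simp_rw [hiso, LinearEquiv.apply_symm_apply, k3HilbertForm_comm 2 (Pi.single _ 1) (φ w')]
    have := k3HilbertForm_inverse_sum (φ y) (φ w')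
    simp_rw [k3HilbertForm_comm 2 (Pi.single _ 1) (φ w')] at this
    exact this
  rw [hL3]
  simp_rw [hL3, hL2, hvv, smul_smul, ← Finset.sum_smul]
  congr 1
  simp only [mul_add, Finset.sum_add_distrib]
  rw [← hS y w, ← hS w y, Finset.sum_mul]
  congr 1
  · congr 1
    · refine Finset.sum_congr rfl fun i _ => ?_
      rw [Finset.sum_mul]
      exact Finset.sum_congr rfl fun j _ => by ring
    · exact Finset.sum_congr rfl fun i _ => Finset.sum_congr rfl fun j _ => by ring
  · exact Finset.sum_congr rfl fun i _ => Finset.sum_congr rfl fun j _ => by ring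

/-- **HC⁴ for marked `K3^{[2]}`-type fourfolds with `SpannedByIsometries X φ`, every Picard rank, from the
algebraicity of the explicit classes `κ_g`**, modulo {Verbitsky–Guan, O'Grady, Voisin}.
[cite: Markman2024, §1.1 Thm. 1.1] [cite: Zarhin1983HodgeGroupsK3, Thm. 1.5.1] -/
theorem hodgeConjectureFor_of_spannedByIsometries_of_kappaClasses
    (hV : VerbitskyGuan_cohomology_K3HilbertSquareType) (hO : OGrady2008_dualBBFClass_algebraic)
    (hcup : Voisin2003_cupProduct_algebraicClasses)
    (hX : IsSmoothProjective 4 X) (hK : IsOfK3HilbertSquareType X) (hM : MarkedK3Sq[X, φ, P, z])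
    (hSp : SpannedByIso[X, φ]) (hκ : Kappa[X, φ]) : HodgeConjectureFor 4 X :=
  hodgeConjectureFor_of_spannedByIsometries_of_graphClasses hV hO hcup hX hK hM hSp
    (graphClasses_of_kappaClasses hM hκ)

/-- **`IsometrySpannedThird` BY NAME, every Picard rank, from three published facts and the algebraicity of the
explicit classes `κ_g`** (module docstring). [cite: Markman2024, §1.1 Thm. 1.1] [cite: Zarhin1983HodgeGroupsK3, Thm. 1.5.1] -/
theorem isometrySpannedThird_of_kappaClasses
    (hV : VerbitskyGuan_cohomology_K3HilbertSquareType) (hO : OGrady2008_dualBBFClass_algebraic)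
    (hcup : Voisin2003_cupProduct_algebraicClasses)
    (hκ : ∀ (X : SchemeOver ℂ), IsSmoothProjective 4 X → IsOfK3HilbertSquareType X →
      ∀ (φ : complexBetti X 2 ≃ₗ[ℂ] (K3HilbertIndex → ℂ)) (P : complexBetti X (2 * 4)) (z : K3HilbertIndex → ℂ),
      MarkedK3Sq[X, φ, P, z] → Kappa[X, φ]) :
    Summit.HodgeConjecture.HodgeConjecture.Theses.MarkmanPartnerTransport.IsometrySpannedThird :=
  isometrySpannedThird_of_graphClasses hV hO hcup fun X hX hK φ P z hM =>
    graphClasses_of_kappaClasses hM (hκ X hX hK φ P z hM)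

end Summit.HodgeConjecture.HodgeConjecture.Theorems.MarkmanPartnerTransport.PartnerLattice

end
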